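import Mathlib
import Summits.ValiantsHypothesis.ValiantsHypothesis.Theorems.GrenetZeonTwoDimCoefficientsScalingShadowFamily
import Summits.ValiantsHypothesis.ValiantsHypothesis.Theorems.GrenetZeonTwoDimCoefficientsScalingClosureShadowSmooth

/-!
# Crux `GrenetZeon.TwoDimCoefficients` (stmt-ValiantsHypothesis-8062), stub `stub_dualUnipotent`:
# scaling-closure — the shadow family for an ARBITRARY affine pair (per-free engine, lemma F1a of EIGHTEENTH-HAND.md)

The 16th hand's ✓ `exists_shadowFamily` builds, for a unipotent dual REPRESENTATION `per_n = α·c + β·tr(adj A·B)`,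
a polynomial `P(z, δ)` whose special fibre `δ = 0` is the shadow `c + β⁻¹per_n + Σ_{k≥2}[D_k]_{kn}` and whose slices
`δ ≠ 0` obey Mignon–Ressayre.  The representation hypothesis is used only to identify `[D_1]_n = β⁻¹·per_n`.  The
numerator-perturbation argument of memo EIGHTEENTH-HAND.md (§NEW: run the engine on `(A, B + θ·C)`, which is NOT a
representation, then specialise `θ → 0`) needs the per-free form:

* ★ `exists_shadowFamily_general` — for ANY affine `A, B` (any `m, n`) with `[D_k]_d = 0` for `d > k·n` and ALL
  `k` (`D_k = [X^k] det(X·B + A)`; for `k = 0` this says `det A` is constant, for `k = 1` that `deg tr(adj A·B) ≤ n`,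
  for `k ≥ 2` it is the companion-degree hypothesis hdeg — all automatic on index-`n` pencils), there is
  `P ∈ ℂ[z, δ]` with special fibre the FULL SHADOW `Σ_{k ≤ m} [D_k]_{kn}` and `rank Hess_z P ≤ 2m` at every zero
  off `δ = 0`.
* `rank_hess0_generalShadow_le_smooth` — consequently `rank Hess Φ(z₀) ≤ 2m` at every SMOOTH zero `z₀` of the shadow
  `Φ = Σ_{k ≤ m} [D_k]_{kn}` (✓ `smoothZeroBound_specialFibre`).

HONEST FRAMING: engine generalisation only; the stub `DualUnipotentBound`, both cruxes (stmt-8062, stmt-24318) and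
`VP ≠ VNP` remain open.

References: T. Mignon, N. Ressayre, Int. Math. Res. Not. 2004:79, Thm. 1.1 (tree `rank_hess0_det_le`); folklore.
-/

-- single-conjunct layout `Summits/ValiantsHypothesis/ValiantsHypothesis`: the duplicated namespace
-- component is mandated by the tree.
set_option linter.dupNamespace false
set_option autoImplicit false

noncomputable section

namespace Summit.ValiantsHypothesis.ValiantsHypothesis.Theorems.GrenetZeonTwoDimCoefficients.ScalingClosure

open MvPolynomial Matrix
open Literature.Computability.AlgebraicComplexity
open Summit.ValiantsHypothesis.ValiantsHypothesis.Cruxes.TwoDimCoefficients.DimTwoCases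

section ShadowGeneral

variable {n m : ℕ}

/-- ★ **The shadow family of an arbitrary affine pair.**  For affine `A, B` with
`[D_k]_d = 0` whenever `d > k·n` (all `k`), there is `P ∈ ℂ[z, δ]` whose special fibre is the full shadow
`Σ_{k ≤ m} [D_k]_{kn}` and whose `z`-Hessian has rank `≤ 2m` at every zero off `δ = 0`.
[cite: MignonRessayre2004, Thm. 1.1 — via the tree; folklore scaling] -/
theorem exists_shadowFamily_general (A B : AffMat n m) (hA : IsAffine A) (hB : IsAffine B)
    (D : ℕ → MvPolynomial (Fin n × Fin n) ℂ)
    (hD : ∀ k, D k = (det ((Polynomial.X : Polynomial (MvPolynomial (Fin n × Fin n) ℂ)) •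
      B.map Polynomial.C + A.map Polynomial.C)).coeff k)
    (hdeg : ∀ k, ∀ d, k * n < d → homogeneousComponent d (D k) = 0) :
    ∃ P : MvPolynomial (Option (Fin n × Fin n)) ℂ,
      (∀ z : Fin n × Fin n → ℂ, eval (fun o : Option (Fin n × Fin n) => o.elim (0 : ℂ) z) P =
        eval z (∑ k ∈ Finset.range (m + 1), homogeneousComponent (k * n) (D k))) ∧
      (∀ x : Option (Fin n × Fin n) → ℂ, x none ≠ 0 → eval x P = 0 →
        ((Matrix.of fun s t : Fin n × Fin n => pderiv (some s) (pderiv (some t) P)).map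
          (eval x)).rank ≤ 2 * m) := by
  classical
  -- homogenised matrices and the coefficient polynomials `E_k`
  set Ah : Matrix (Fin m) (Fin m) (MvPolynomial (Option (Fin n × Fin n)) ℂ) :=
    Matrix.of fun i j => rename some (homogeneousComponent 1 (A i j)) +
      MvPolynomial.C (coeff 0 (A i j)) * X none with hAh_def
  set Bh : Matrix (Fin m) (Fin m) (MvPolynomial (Option (Fin n × Fin n)) ℂ) :=
    Matrix.of fun i j => rename some (homogeneousComponent 1 (B i j)) +
      MvPolynomial.C (coeff 0 (B i j)) * X none with hBh_def
  have hAh : ∀ i j, Ah i j = rename some (homogeneousComponent 1 (A i j)) +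
      MvPolynomial.C (coeff 0 (A i j)) * X none := fun i j => rfl
  have hBh : ∀ i j, Bh i j = rename some (homogeneousComponent 1 (B i j)) +
      MvPolynomial.C (coeff 0 (B i j)) * X none := fun i j => rfl
  set E : ℕ → MvPolynomial (Option (Fin n × Fin n)) ℂ := fun k =>
    (det ((Polynomial.X : Polynomial (MvPolynomial (Option (Fin n × Fin n)) ℂ)) •
      Bh.map Polynomial.C + Ah.map Polynomial.C)).coeff k with hE
  -- the tail polynomials `Q_k = Σ_{d ≤ kn} δ^{kn-d}·[D_k]_d` (ALL `k`) and the family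
  set Q : ℕ → MvPolynomial (Option (Fin n × Fin n)) ℂ := fun k =>
    ∑ d ∈ Finset.range (k * n + 1), (X none) ^ (k * n - d) *
      rename some (homogeneousComponent d (D k)) with hQ
  set P : MvPolynomial (Option (Fin n × Fin n)) ℂ := ∑ k ∈ Finset.range (m + 1), Q k with hP
  set M : Matrix (Fin m) (Fin m) (MvPolynomial (Option (Fin n × Fin n)) ℂ) :=
    (X none : MvPolynomial (Option (Fin n × Fin n)) ℂ) ^ n • Bh + Ah with hM
  -- the polynomial identity `det M = δ^m · P`, proved off `δ = 0`
  have hdetM : M.det = (X none) ^ m * P := by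
    apply eq_of_eval_eq_off_slice
    intro d hd z
    set x : Option (Fin n × Fin n) → ℂ := fun o => o.elim d z with hx
    have hXn : eval x (X none : MvPolynomial (Option (Fin n × Fin n)) ℂ) = d := by
      simp only [MvPolynomial.eval_X, hx, Option.elim]
    have hEk : ∀ k, eval x (E k) = d ^ m * eval (d⁻¹ • z) (D k) := fun k => by
      rw [hD]
      exact eval_coeff_det_homog A B hA hB Ah Bh hAh hBh hd z k
    have hQk : ∀ k, eval x (Q k) = d ^ (k * n) * eval (d⁻¹ • z) (D k) := by
      intro k
      rw [pow_mul_eval_inv_smul (D k) (k * n) (hdeg k) hd z, hQ]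
      simp only [map_sum, map_mul, map_pow, hXn, MvPolynomial.eval_rename]
      rfl
    have hL : eval x M.det = ∑ k ∈ Finset.range (m + 1), eval x (E k) * (d ^ n) ^ k := by
      have h := congrArg (eval x) (det_smul_add_eq_sum_coeff
        ((X none : MvPolynomial (Option (Fin n × Fin n)) ℂ) ^ n) Ah Bh)
      rw [Fintype.card_fin, map_sum] at h
      rw [hM, h]
      refine Finset.sum_congr rfl fun k _ => ?_
      rw [map_mul, map_pow, map_pow, hXn]
    rw [map_mul, map_pow, hXn, hL, hP, map_sum, Finset.mul_sum]
    refine Finset.sum_congr rfl fun k _ => ?_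
    rw [hEk, hQk, ← pow_mul, mul_comm n k]
    ring
  refine ⟨P, ?_, ?_⟩
  · -- the special fibre is the full shadow
    intro z
    have hcomp : ((fun o : Option (Fin n × Fin n) => o.elim (0 : ℂ) z) ∘ some) = z :=
      funext fun _ => rfl
    have hQ0 : ∀ k, eval (fun o : Option (Fin n × Fin n) => o.elim (0 : ℂ) z) (Q k) =
        eval z (homogeneousComponent (k * n) (D k)) := by
      intro k
      rw [hQ]
      simp only [map_sum, map_mul, map_pow, MvPolynomial.eval_X, MvPolynomial.eval_rename, hcomp,
        Option.elim_none]
      rw [Finset.sum_eq_single (k * n)]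
      · rw [Nat.sub_self, pow_zero, one_mul]
      · intro d hd hne
        have hlt : d < k * n := lt_of_le_of_ne (Nat.lt_succ_iff.mp (Finset.mem_range.mp hd)) hne
        rw [zero_pow (by omega : k * n - d ≠ 0), zero_mul]
      · intro h
        exact absurd (Finset.mem_range.mpr (Nat.lt_succ_self _)) h
    rw [hP, map_sum, map_sum]
    exact Finset.sum_congr rfl fun k _ => hQ0 k
  · -- Mignon–Ressayre on the slices `δ = δ₀ ≠ 0`
    intro x hx0 hxP
    set d : ℂ := x none with hd
    set z : Fin n × Fin n → ℂ := fun s => x (some s) with hz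
    have hx : x = fun o : Option (Fin n × Fin n) => o.elim d z := by
      funext o
      cases o <;> rfl
    set g : Option (Fin n × Fin n) → MvPolynomial (Fin n × Fin n) ℂ :=
      fun o => o.elim (MvPolynomial.C d) X with hg
    set Pd : MvPolynomial (Fin n × Fin n) ℂ := aeval g P with hPd
    have hslice : ∀ z' : Fin n × Fin n → ℂ,
        eval (fun o : Option (Fin n × Fin n) => o.elim d z') P = eval z' Pd :=
      fun z' => (eval_aeval_slice P d z').symm
    have hHx : (Matrix.of fun s t : Fin n × Fin n => pderiv (some s) (pderiv (some t) P)).map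
        (eval x) = hess0 (transl z Pd) := by
      rw [hx]
      exact hessian_slice P Pd d hslice z
    set Md : Matrix (Fin m) (Fin m) (MvPolynomial (Fin n × Fin n) ℂ) := M.map (aeval g) with hMd
    have hgX : aeval g (X none : MvPolynomial (Option (Fin n × Fin n)) ℂ) = MvPolynomial.C d := by
      rw [MvPolynomial.aeval_X, hg]
      rfl
    have hMd_aff : ∀ i j, (Md i j).totalDegree ≤ 1 := by
      intro i j
      rw [hMd, hM, Matrix.map_apply, Matrix.add_apply, Matrix.smul_apply, map_add, smul_eq_mul,
        map_mul, map_pow, hgX, ← map_pow]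
      refine (totalDegree_add _ _).trans (max_le ?_ ?_)
      · refine (totalDegree_mul _ _).trans ?_
        rw [totalDegree_C, zero_add]
        exact totalDegree_aeval_homog_le d
      · exact totalDegree_aeval_homog_le d
    have hdetMd : Md.det = MvPolynomial.C (d ^ m) * Pd := by
      rw [hMd, ← AlgHom.mapMatrix_apply, ← AlgHom.map_det, hdetM, map_mul, map_pow, hgX, ← map_pow]
    set A' : Matrix (Fin m) (Fin m) (MvPolynomial (Fin n × Fin n) ℂ) :=
      (transl z).mapMatrix Md with hA'
    have hA'aff : ∀ i j, (A' i j).totalDegree ≤ 1 := fun i j => by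
      rw [hA', AlgHom.mapMatrix_apply, Matrix.map_apply]
      exact (totalDegree_transl_le _ _).trans (hMd_aff i j)
    have hA'det : A'.det = MvPolynomial.C (d ^ m) * transl z Pd := by
      rw [hA', ← AlgHom.map_det, hdetMd, map_mul, transl_C]
    have hcc : constantCoeff A'.det = 0 := by
      rw [hA'det, map_mul, constantCoeff_C, constantCoeff_transl, ← hslice z, ← hx, hxP, mul_zero]
    have hr := rank_hess0_det_le A' hA'aff hcc
    rw [hA'det, hess0_C_mul, rank_smul_eq (pow_ne_zero _ hx0)] at hr
    rw [hHx]
    exact hr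

/-- ★ **Mignon–Ressayre for the full shadow of an arbitrary affine pair.**  Under the hypotheses of
`exists_shadowFamily_general`, at every zero `z₀` of the shadow `Φ = Σ_{k ≤ m} [D_k]_{kn}` with some `∂_i Φ(z₀) ≠ 0`:
`rank Hess Φ(z₀) ≤ 2m`. [cite: MignonRessayre2004, Thm. 1.1 — via the tree; folklore] -/
theorem rank_hess0_generalShadow_le_smooth (A B : AffMat n m) (hA : IsAffine A) (hB : IsAffine B)
    (D : ℕ → MvPolynomial (Fin n × Fin n) ℂ)
    (hD : ∀ k, D k = (det ((Polynomial.X : Polynomial (MvPolynomial (Fin n × Fin n) ℂ)) •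
      B.map Polynomial.C + A.map Polynomial.C)).coeff k)
    (hdeg : ∀ k, ∀ d, k * n < d → homogeneousComponent d (D k) = 0)
    (z₀ : Fin n × Fin n → ℂ)
    (hz : eval z₀ (∑ k ∈ Finset.range (m + 1), homogeneousComponent (k * n) (D k)) = 0)
    (hsmooth : ∃ i, eval z₀ (pderiv i (∑ k ∈ Finset.range (m + 1), homogeneousComponent (k * n) (D k))) ≠ 0) :
    (hess0 (transl z₀ (∑ k ∈ Finset.range (m + 1), homogeneousComponent (k * n) (D k)))).rank ≤ 2 * m := by
  obtain ⟨P, h0, hMR⟩ := exists_shadowFamily_general A B hA hB D hD hdeg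
  exact smoothZeroBound_specialFibre P _ (2 * m) h0 (fun x hx hP _ => hMR x hx hP) z₀ hz hsmooth

end ShadowGeneral

end Summit.ValiantsHypothesis.ValiantsHypothesis.Theorems.GrenetZeonTwoDimCoefficients.ScalingClosure

end
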